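import Summits.Ventures.PercRepro.C025ProfilePLDColPlaneTwelve

/-!
# THE COLOOP TRICK'S COROLLARY: C-025 ON EVERY TRUNCATION OF «(PLD)-MATROID OF RANK ≤ 12 ⊕ A 5-POINT PLANE ⊕ A COLOOP ⊕ FREE POINTS» (night-3 g36)

`proofs/NIGHT3-G36-CEILING.md` §2 (d).  `PLDColoop.pld_disjointSum_uniform_3_5_coloop_of_eRank_le_12` gives (PLD) for
`M ⊕ (U_{3,5} ⊕ U_{1,1})` from (PLD)(M) at rank ≤ 12, and the bridge `PLDBridge.rls_disjointSum_freeOn_of_pld` turns (PLD) into C-025 at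
every `(p, q)` on every truncation of «· ⊕ free points».  So C-025 holds on every truncation of «M ⊕ a 5-point plane ⊕ free points» as
soon as there is at least one free point, for EVERY (PLD)-matroid `M` of rank ≤ 12 — the first tower's plane floor stops at rank 8
(`C025ProfilePLDPlaneFarkasNine`), and it is the coloop (a free point absorbed into the summand) that carries the certificates past it.
No `def`, no `instance`, no notation.  Axioms: standard.
-/

open scoped Matroid

namespace PercRepro

open Finset ThmH

namespace PLDColoop

variable {α : Type} [DecidableEq α]

/-- C-025 AT EVERY `(p, q)` ON EVERY TRUNCATION OF «(PLD)-MATROID OF RANK ≤ 12 ⊕ A 5-POINT PLANE ⊕ A COLOOP ⊕ FREE POINTS». -/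
theorem rls_truncate_disjointSum_plane_five_coloop_freeOn_of_pld_twelve (M : Matroid α) [M.Finite] (hr : M.eRank ≤ 12)
    (hPLD : ∀ lo hi δ Θ : ℕ, Θ ≤ lo + hi + δ → (lo = 0 ∨ lo + hi + δ ≤ Θ) →
      (∑ I ∈ (gr M).powerset, (if lo ≤ (M.eRk (I : Set α)).toNat ∧ (M.eRk (I : Set α)).toNat ≤ hi ∧
          Θ ≤ (M.eRk ((gr M \ I : Finset α) : Set α)).toNat + (M.eRk (I : Set α)).toNat then
          ((M.eRk ((gr M \ I : Finset α) : Set α)).toNat).choose δ else 0)) ≤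
        ∑ I ∈ (gr M).powerset, (if lo + δ ≤ (M.eRk ((gr M \ I : Finset α) : Set α)).toNat ∧
          (M.eRk ((gr M \ I : Finset α) : Set α)).toNat ≤ hi + δ then
          ((M.eRk ((gr M \ I : Finset α) : Set α)).toNat).choose δ else 0))
    (F F' : Finset α) (hF : F.card = 5) (hF' : F'.card = 1)
    (h' : Disjoint (@Matroid.truncate α (Matroid.freeOn (F : Set α)) (PLDTruncate.freeOn_finite' F) 3).E (@Matroid.truncate α (Matroid.freeOn (F' : Set α)) (PLDTruncate.freeOn_finite' F') 1).E)
    (h : Disjoint M.E ((@Matroid.truncate α (Matroid.freeOn (F : Set α)) (PLDTruncate.freeOn_finite' F) 3).disjointSum (@Matroid.truncate α (Matroid.freeOn (F' : Set α)) (PLDTruncate.freeOn_finite' F') 1) h').E)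
    (E₃ : Finset α)
    (h₃ : Disjoint (M.disjointSum ((@Matroid.truncate α (Matroid.freeOn (F : Set α)) (PLDTruncate.freeOn_finite' F) 3).disjointSum (@Matroid.truncate α (Matroid.freeOn (F' : Set α)) (PLDTruncate.freeOn_finite' F') 1) h') h).E (E₃ : Set α))
    (r p q : ℕ) :
    haveI := PLDTruncate.freeOn_finite' F
    haveI := PLDTruncate.freeOn_finite' F'
    haveI := PLDClosure.disjointSum_finite' _ _ h'
    haveI := PLDClosure.disjointSum_finite' _ _ h
    haveI := PLDBridge.disjointSum_freeOn_finite _ E₃ h₃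
    ThmN.RLS (PercRepro.Matroid.truncate ((M.disjointSum ((@Matroid.truncate α (Matroid.freeOn (F : Set α)) (PLDTruncate.freeOn_finite' F) 3).disjointSum (@Matroid.truncate α (Matroid.freeOn (F' : Set α)) (PLDTruncate.freeOn_finite' F') 1) h') h).disjointSum (Matroid.freeOn (E₃ : Set α)) h₃) r) p q := by
  haveI := PLDTruncate.freeOn_finite' F
  haveI := PLDTruncate.freeOn_finite' F'
  haveI := PLDClosure.disjointSum_finite' _ _ h'
  haveI := PLDClosure.disjointSum_finite' _ _ h
  exact PLDBridge.rls_disjointSum_freeOn_of_pld _ E₃ h₃ r p q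
    (pld_disjointSum_uniform_3_5_coloop_of_eRank_le_12 M hr hPLD F F' hF hF' h' h)

end PLDColoop

end PercRepro
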